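import Literature.Analysis.FluidPDE.ClassicalStrainSupShadowing
import Literature.Analysis.FluidPDE.TaoQuantitativeClass
import Literature.Analysis.FluidPDE.NSTaoClassOfSobolevDatum
import Literature.Analysis.FluidPDE.TaoLocalisationProofs
import Summits.NavierStokesRegularity.FluidComputer.ClayEvolutionAprioriContinuation

/-!
# THE STRAIN-SHADOWED RUN: a free classical run from a Clay datum exists on the whole slab next to a
# forced (pseudo-)run and stays sup-close to it — exponential fee in STRAIN TIMES `∫ Γ`

Cell `ns-blowup`, seat `ns-blowup-fc-prover-3` (g10; bears_on LADDER-NS N1, route `PalasekTowerBreakdown`,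
crux `EpisodeBase` = item stmt-NavierStokesRegularity-19179, line `straindoor` (cstrat-19179), stub
`stub_strain_door`, route (A)). LABEL: E–C typing + kernel analysis (theorems only; no definition, no
named fact, no `sorry`). WHAT THIS IS NOT: not Navier–Stokes evidence — an EXISTENCE-AND-CLOSENESS
theorem next to a GIVEN forced run on a FIXED slab; no run meeting any letter; no verdict on 19179.

Unit viscosity, slab `[0, T]`. Reference: a classical solution `(w, ϖ)` FORCED by `g` (jointly
continuous, bounded, weakly divergence free, `‖g(t)‖₂ ≤ G₂` — the Leray-projected defect of a
pseudo-run), finite energy, Tao's `L²`-Sobolev class, `‖w‖ ≤ B_w`, continuous strain majorant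
`−⟪ξ, Dw(t,x)ξ⟫ ≤ Γ(t)‖ξ‖²` (`Γ ≥ 0`). Datum `U` smooth, compactly supported, divergence free,
`‖w(0) − U‖_∞ ≤ D`, `‖U − w(0)‖₂ ≤ E₀`. Window `h > 0` with `(24 C₀ (2B_w+1))² h ≤ 1`
(`C₀ = oseenSliceConst ℝ³`), tolerance `δ ≤ 1/2` with `2 (D + 4h^{1/4}G₂) e^{36C₀²(2B_w+1)²h} ≤ δ` and
`2 ((E₀ + G₂T) e^{∫₀ᵀΓ} + 4G₂h) h^{-3/4} ≤ δ`. THEN (`exists_freeRun_near_of_strain`) the free classical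
finite-energy run `v` from `v(0) = U` EXISTS on `[0, T] × ℝ³` and `‖v − w‖ ≤ δ` there. The exponential
fee is `e^{∫₀ᵀ Γ}` (strain times); the speed `B_w` enters only through `h ~ (C₀B_w)^{-2}` and `h^{-3/4}`
(the sup-norm door `ShadowedRun.exists_free_run_near_mildRef` pays `e^{36C₀²(2B_w+1)²T}` instead —
priced out at the register, `PalasekTowerGermHostShadowedRunPrice`).

§1 `freeRun_near_of_strain_of_bound`: a free run from `U` bounded by `B_w + 1` is Tao-class with a
Tao-class pressure (`IsHkClassicalSolutionOn.exists_isTaoSolutionOn`), so the a-priori shadowing theorems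
`norm_sub_le_of_strain_initialLayer` (`t ≤ h`) / `norm_sub_le_of_strain_window` (`t > h`: strain-rate `L²`
stability + `L² → L^∞` smoothing on `[t−h, t]`) apply. §2 `freeRun_near_of_strain`: the bound `B_w + 1`
holds automatically (time-Lipschitz induction, `∂ₜv ∈ L^∞`). §3 `exists_freeRun_near_of_strain`: the
a-priori bound `B_w + 1/2` fed to `ClayEvolution.exists_classical_Icc_of_apriori_bound`.
References: [cite: DashtiRobinson2008, Thm. 5] [cite: RobinsonRodrigoSadowski2016, Thm. 9.1]
[cite: Leray1934, §19 (3.4)–(3.8)] [cite: Tao2011, Thm. 5.4 (ii)+(iv)] [cite: Palasek2026ElementaryModel, §4].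
-/


noncomputable section

namespace Summit.NavierStokesRegularity.FluidComputer.PalasekTowerClayBridge.StrainShadow

open Set MeasureTheory Filter Topology Function InnerProductSpace
open scoped ENNReal NNReal ContDiff RealInnerProductSpace
open Literature.Analysis Literature.Analysis.FluidPDE

/-- A smooth compactly supported field on `ℝ³` is rapidly decaying (Fefferman's (4)).
[cite: FeffermanClay2006, (4)] -/
private theorem hasRapidSpatialDecay_of_hasCompactSupport
    {φ : EuclideanSpace ℝ (Fin 3) → EuclideanSpace ℝ (Fin 3)} (hsm : ContDiff ℝ ∞ φ)
    (hc : HasCompactSupport φ) : HasRapidSpatialDecay φ := by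
  intro n K
  have hcont : Continuous fun x => (1 + ‖x‖) ^ K * ‖iteratedFDeriv ℝ n φ x‖ :=
    ((continuous_const.add continuous_norm).pow K).mul
      (hsm.continuous_iteratedFDeriv (m := n) (mod_cast le_top)).norm
  have hsupp : HasCompactSupport fun x => (1 + ‖x‖) ^ K * ‖iteratedFDeriv ℝ n φ x‖ :=
    ((hc.iteratedFDeriv n).norm).mul_left
  obtain ⟨C, hC⟩ := hcont.bounded_above_of_compact_support hsupp
  exact ⟨C, fun x => by have h := hC x; rwa [Real.norm_eq_abs, abs_of_nonneg (by positivity)] at h⟩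

/-- From `∫⁻ ‖f‖ₑ² ≤ C` to `eLpNorm f 2 ≤ √C`. (Plumbing.) [folklore] -/
private theorem eLpNorm_le_sqrt_of_lintegral_sq_le {G : Type*} [NormedAddCommGroup G]
    {f : EuclideanSpace ℝ (Fin 3) → G} {C : ℝ≥0} (h : ∫⁻ x, ‖f x‖ₑ ^ 2 ≤ C) : eLpNorm f 2 volume ≤ (NNReal.sqrt C : ℝ≥0∞) := by
  rw [lintegral_enorm_sq_eq_eLpNorm_two_sq] at h
  have h2 : eLpNorm f 2 volume = (eLpNorm f 2 volume ^ 2) ^ (1 / 2 : ℝ) := by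
    rw [← ENNReal.rpow_natCast, ← ENNReal.rpow_mul]; norm_num
  rw [h2]
  calc (eLpNorm f 2 volume ^ 2) ^ (1 / 2 : ℝ) ≤ (C : ℝ≥0∞) ^ (1 / 2 : ℝ) :=
        ENNReal.rpow_le_rpow h (by norm_num)
    _ = (NNReal.sqrt C : ℝ≥0∞) := by
        rw [NNReal.sqrt_eq_rpow, ENNReal.coe_rpow_of_nonneg _ (by norm_num)]

/-! ## §1 Free runs bounded by `B_w + 1` stay `δ`-close to the reference -/

section Near

variable {T Bw Gb G₂r D E₀ h δ : ℝ}
  {w g : ℝ → EuclideanSpace ℝ (Fin 3) → EuclideanSpace ℝ (Fin 3)}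
  {ϖ : ℝ → EuclideanSpace ℝ (Fin 3) → ℝ} {Γ : ℝ → ℝ}
  {U : EuclideanSpace ℝ (Fin 3) → EuclideanSpace ℝ (Fin 3)}

/-- **Every free run from `U` on `[0, s] ⊆ [0, T]` that is bounded by `B_w + 1` stays `δ`-close to the
reference** (hypotheses of the module docstring; Tao class + initial layer + terminal window).
[cite: DashtiRobinson2008, Thm. 5] [cite: Tao2011, Thm. 5.4 (ii)+(iv)] -/
theorem freeRun_near_of_strain_of_bound (hT : 0 < T)
    (hw : IsClassicalNSSolutionOn (Icc 0 T) 1 g w ϖ)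
    (hgc : Continuous (uncurry g)) (hGb : ∀ τ ∈ Icc 0 T, ∀ y, ‖g τ y‖ ≤ Gb)
    (hgdiv : ∀ τ ∈ Icc 0 T, IsWeaklyDivFree (g τ)) (hG₂r : 0 ≤ G₂r)
    (hg2 : ∀ τ ∈ Icc 0 T, eLpNorm (g τ) 2 volume ≤ ENNReal.ofReal G₂r)
    (hEw : ∃ C : ℝ≥0∞, C < ⊤ ∧ ∀ t ∈ Icc 0 T, ∫⁻ x, ‖w t x‖ₑ ^ 2 ≤ C)
    (hwS : HasBoundedSobolevNormsOn (Icc 0 T) w)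
    (hwt : HasBoundedSobolevNormsOn (Icc 0 T) (FluidPDE.timeDerivWithin (Icc 0 T) w))
    (hϖS : ∀ n : ℕ, ∃ C' : ℝ≥0, ∀ t ∈ Icc 0 T, ∫⁻ x, ‖iteratedFDeriv ℝ n (ϖ t) x‖ₑ ^ 2 ≤ C')
    (hBw : 0 < Bw) (hbw : ∀ t ∈ Icc 0 T, ∀ y, ‖w t y‖ ≤ Bw)
    (hΓc : ContinuousOn Γ (Icc 0 T)) (hΓ0 : ∀ t ∈ Icc 0 T, 0 ≤ Γ t)
    (hΓ : ∀ t ∈ Icc 0 T, ∀ x ξ, -⟪ξ, fderiv ℝ (w t) x ξ⟫ ≤ Γ t * ‖ξ‖ ^ 2)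
    (hU : ContDiff ℝ ∞ U) (hUc : HasCompactSupport U)
    (hD : ∀ y, ‖w 0 y - U y‖ ≤ D) (hE₀ : 0 ≤ E₀) (hE0 : ∫ x, ‖U x - w 0 x‖ ^ 2 ≤ E₀ ^ 2)
    (hh : 0 < h) (hTs : (24 * oseenSliceConst (EuclideanSpace ℝ (Fin 3)) * (Bw + 1 + Bw)) ^ 2 * h ≤ 1)
    (hδ₁ : 2 * (D + 4 * h ^ (1 / 4 : ℝ) * G₂r) *
      Real.exp (36 * oseenSliceConst (EuclideanSpace ℝ (Fin 3)) ^ 2 * (Bw + 1 + Bw) ^ 2 * h) ≤ δ)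
    (hδ₂ : 2 * ((E₀ + G₂r * T) * Real.exp (∫ s in (0 : ℝ)..T, Γ s) + 4 * G₂r * h) * h ^ (-(3 / 4 : ℝ)) ≤ δ)
    {s : ℝ} (hs0 : 0 < s) (hsT : s ≤ T)
    {v : ℝ → EuclideanSpace ℝ (Fin 3) → EuclideanSpace ℝ (Fin 3)} {q₀ : ℝ → EuclideanSpace ℝ (Fin 3) → ℝ}
    (hv : IsClassicalNSSolutionOn (Icc 0 s) 1 0 v q₀) (hv0 : v 0 = U)
    (hEv : ∃ C : ℝ≥0∞, C < ⊤ ∧ ∀ t ∈ Icc 0 s, ∫⁻ x, ‖v t x‖ₑ ^ 2 ≤ C)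
    (hbv : ∀ t ∈ Icc 0 s, ∀ y, ‖v t y‖ ≤ Bw + 1) :
    ∀ t ∈ Icc 0 s, ∀ x, ‖v t x - w t x‖ ≤ δ := by
  have hsub : Icc 0 s ⊆ Icc 0 T := Icc_subset_Icc le_rfl hsT
  have hUs : UniqueDiffOn ℝ (Icc 0 s) := uniqueDiffOn_Icc hs0
  have hdec : HasRapidSpatialDecay U := hasRapidSpatialDecay_of_hasCompactSupport hU hUc
  have h₀ : ∀ m : ℕ, ∫⁻ x, ‖iteratedFDeriv ℝ m (v 0) x‖ₑ ^ 2 < ⊤ := fun m => by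
    rw [hv0]; exact hdec.lintegral_enorm_iteratedFDeriv_sq_lt_top m
  have hEv_nn : ∃ C : ℝ≥0, ∀ t ∈ Icc 0 s, ∫⁻ x, ‖v t x‖ₑ ^ 2 ≤ C := by
    obtain ⟨C, hC, hb⟩ := hEv
    exact ⟨C.toNNReal, fun t ht => (hb t ht).trans (ENNReal.coe_toNNReal hC.ne).ge⟩
  have hvSob : HasBoundedSobolevNormsOn (Icc 0 s) v :=
    hv.hasBoundedSobolevNormsOn_of_sobolevDatum_unforced one_pos hs0 hEv_nn h₀
  have hHk : IsHkClassicalSolutionOn (Icc 0 s) v q₀ := by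
    refine ⟨hv, fun n => ?_⟩
    obtain ⟨C, hC⟩ := hvSob n
    exact ⟨NNReal.sqrt C, fun t ht => eLpNorm_le_sqrt_of_lintegral_sq_le (hC t ht)⟩
  obtain ⟨q, hTao⟩ := hHk.exists_isTaoSolutionOn hs0
  have hv' : IsClassicalNSSolutionOn (Icc 0 s) 1 0 v q := hTao.classical
  have hw' : IsClassicalNSSolutionOn (Icc 0 s) 1 g w ϖ := hw.mono hsub hUs
  have hEw' : ∃ C : ℝ≥0∞, C < ⊤ ∧ ∀ t ∈ Icc 0 s, ∫⁻ x, ‖w t x‖ₑ ^ 2 ≤ C := by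
    obtain ⟨C, hC, hb⟩ := hEw; exact ⟨C, hC, fun t ht => hb t (hsub ht)⟩
  have hwS' : HasBoundedSobolevNormsOn (Icc 0 s) w := fun n => by
    obtain ⟨C, hC⟩ := hwS n; exact ⟨C, fun t ht => hC t (hsub ht)⟩
  have hwt' : HasBoundedSobolevNormsOn (Icc 0 s) (FluidPDE.timeDerivWithin (Icc 0 s) w) := by
    intro n
    obtain ⟨C, hC⟩ := hwt n
    refine ⟨C, fun t ht => ?_⟩
    have heq : FluidPDE.timeDerivWithin (Icc 0 s) w t = FluidPDE.timeDerivWithin (Icc 0 T) w t :=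
      funext (hw.smooth_velocity.timeDerivWithin_eq_of_subset hsub hUs ht)
    rw [heq]
    exact hC t (hsub ht)
  have hϖS' : ∀ n : ℕ, ∃ C' : ℝ≥0, ∀ t ∈ Icc 0 s, ∫⁻ x, ‖iteratedFDeriv ℝ n (ϖ t) x‖ₑ ^ 2 ≤ C' :=
    fun n => by obtain ⟨C, hC⟩ := hϖS n; exact ⟨C, fun t ht => hC t (hsub ht)⟩
  have hBv : (0 : ℝ) < Bw + 1 := by linarith
  have hDvw : ∀ y, ‖w 0 y - v 0 y‖ ≤ D := fun y => by rw [hv0]; exact hD y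
  have hE0' : ∫ x, ‖v 0 x - w 0 x‖ ^ 2 ≤ E₀ ^ 2 := by rw [hv0]; exact hE0
  have hTs1 : (24 * oseenSliceConst (EuclideanSpace ℝ (Fin 3)) * (Bw + 1 + Bw)) ^ 2 * h ≤ (1 : ℝ) := hTs
  intro t ht x
  rcases le_or_gt t h with hth | hth
  · -- the initial layer `t ≤ h`
    have h1 := norm_sub_le_of_strain_initialLayer (ν := 1) one_pos hv' hw' hgc
      (fun τ hτ => hGb τ (hsub hτ)) (fun τ hτ => hgdiv τ (hsub hτ)) hG₂r (fun τ hτ => hg2 τ (hsub hτ))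
      hEv hEw' hBv hBw hbv (fun τ hτ => hbw τ (hsub hτ)) hDvw hh ht hth x
    rw [norm_sub_rev]
    refine h1.trans (le_trans ?_ hδ₁)
    have hexp : Real.exp (36 * oseenSliceConst (EuclideanSpace ℝ (Fin 3)) ^ 2 * (Bw + 1 + Bw) ^ 2 / 1 * t)
        ≤ Real.exp (36 * oseenSliceConst (EuclideanSpace ℝ (Fin 3)) ^ 2 * (Bw + 1 + Bw) ^ 2 * h) := by
      rw [div_one]
      exact Real.exp_le_exp.2 (mul_le_mul_of_nonneg_left hth (by positivity))
    have hD0 : 0 ≤ D := (norm_nonneg _).trans (hD 0)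
    have hpre : 0 ≤ 2 * (D + 4 * (1 : ℝ) ^ (-(3 / 4 : ℝ)) * h ^ (1 / 4 : ℝ) * G₂r) := by positivity
    calc 2 * (D + 4 * (1 : ℝ) ^ (-(3 / 4 : ℝ)) * h ^ (1 / 4 : ℝ) * G₂r) *
          Real.exp (36 * oseenSliceConst (EuclideanSpace ℝ (Fin 3)) ^ 2 * (Bw + 1 + Bw) ^ 2 / 1 * t)
        ≤ 2 * (D + 4 * (1 : ℝ) ^ (-(3 / 4 : ℝ)) * h ^ (1 / 4 : ℝ) * G₂r) *
          Real.exp (36 * oseenSliceConst (EuclideanSpace ℝ (Fin 3)) ^ 2 * (Bw + 1 + Bw) ^ 2 * h) :=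
          mul_le_mul_of_nonneg_left hexp hpre
      _ = 2 * (D + 4 * h ^ (1 / 4 : ℝ) * G₂r) *
          Real.exp (36 * oseenSliceConst (EuclideanSpace ℝ (Fin 3)) ^ 2 * (Bw + 1 + Bw) ^ 2 * h) := by
          rw [Real.one_rpow, mul_one]
  · -- the terminal window
    have h1 := norm_sub_le_of_strain_window (ν := 1) one_pos hs0 hv' hw' hgc
      (fun τ hτ => hGb τ (hsub hτ)) (fun τ hτ => hgdiv τ (hsub hτ)) hG₂r (fun τ hτ => hg2 τ (hsub hτ))
      hEv hEw' hTao.sobolev hTao.sobolev_dt hTao.sobolev_p hwS' hwt' hϖS' hBv hBw hbv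
      (fun τ hτ => hbw τ (hsub hτ)) (hΓc.mono hsub) (fun τ hτ => hΓ0 τ (hsub hτ))
      (fun τ hτ => hΓ τ (hsub hτ)) hE₀ hE0' hh hTs1 ht hth x
    rw [norm_sub_rev]
    refine h1.trans (le_trans ?_ hδ₂)
    have hth' : 0 ≤ t - h := by linarith
    have hthT : t - h ≤ T := by linarith [ht.2]
    have hΓi : IntervalIntegrable Γ volume 0 T := hΓc.intervalIntegrable_of_Icc hT.le
    have hΓ_ae : 0 ≤ᵐ[volume.restrict (Ioc 0 T)] Γ :=
      (ae_restrict_iff' measurableSet_Ioc).2 (Eventually.of_forall fun σ hσ =>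
        hΓ0 σ (Ioc_subset_Icc_self hσ))
    have hint : ∫ σ in (0 : ℝ)..(t - h), Γ σ ≤ ∫ σ in (0 : ℝ)..T, Γ σ :=
      intervalIntegral.integral_mono_interval le_rfl hth' hthT hΓ_ae hΓi
    have hexp : Real.exp (∫ σ in (0 : ℝ)..(t - h), Γ σ) ≤ Real.exp (∫ σ in (0 : ℝ)..T, Γ σ) :=
      Real.exp_le_exp.2 hint
    have hlin : E₀ + G₂r * (t - h) ≤ E₀ + G₂r * T := by nlinarith
    have hA : (E₀ + G₂r * (t - h)) * Real.exp (∫ σ in (0 : ℝ)..(t - h), Γ σ) ≤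
        (E₀ + G₂r * T) * Real.exp (∫ σ in (0 : ℝ)..T, Γ σ) :=
      mul_le_mul hlin hexp (Real.exp_nonneg _) (by positivity)
    have hh34 : 0 ≤ h ^ (-(3 / 4 : ℝ)) := Real.rpow_nonneg hh.le _
    rw [Real.one_rpow, mul_one, mul_one]
    have : 2 * ((E₀ + G₂r * (t - h)) * Real.exp (∫ σ in (0 : ℝ)..(t - h), Γ σ) + 4 * G₂r * h) ≤
        2 * ((E₀ + G₂r * T) * Real.exp (∫ σ in (0 : ℝ)..T, Γ σ) + 4 * G₂r * h) := by linarith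
    exact mul_le_mul_of_nonneg_right this hh34

/-! ## §2 The bootstrap bound holds automatically (time-Lipschitz induction) -/

/-- **Every free run from `U` stays `δ`-close to the reference and below `B_w + 1/2`** (no a-priori
bound: `∂ₜv ∈ L^∞` makes `v` Lipschitz in time, so `B_w + 1/2` up to `kτ` gives `B_w + 1` up to `(k+1)τ`,
which §1 improves back; induction on `k`). [cite: DashtiRobinson2008, Thm. 5] [cite: Tao2011, Thm. 5.4 (ii)+(iv)] -/
theorem freeRun_near_of_strain (hT : 0 < T)
    (hw : IsClassicalNSSolutionOn (Icc 0 T) 1 g w ϖ)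
    (hgc : Continuous (uncurry g)) (hGb : ∀ τ ∈ Icc 0 T, ∀ y, ‖g τ y‖ ≤ Gb)
    (hgdiv : ∀ τ ∈ Icc 0 T, IsWeaklyDivFree (g τ)) (hG₂r : 0 ≤ G₂r)
    (hg2 : ∀ τ ∈ Icc 0 T, eLpNorm (g τ) 2 volume ≤ ENNReal.ofReal G₂r)
    (hEw : ∃ C : ℝ≥0∞, C < ⊤ ∧ ∀ t ∈ Icc 0 T, ∫⁻ x, ‖w t x‖ₑ ^ 2 ≤ C)
    (hwS : HasBoundedSobolevNormsOn (Icc 0 T) w)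
    (hwt : HasBoundedSobolevNormsOn (Icc 0 T) (FluidPDE.timeDerivWithin (Icc 0 T) w))
    (hϖS : ∀ n : ℕ, ∃ C' : ℝ≥0, ∀ t ∈ Icc 0 T, ∫⁻ x, ‖iteratedFDeriv ℝ n (ϖ t) x‖ₑ ^ 2 ≤ C')
    (hBw : 0 < Bw) (hbw : ∀ t ∈ Icc 0 T, ∀ y, ‖w t y‖ ≤ Bw)
    (hΓc : ContinuousOn Γ (Icc 0 T)) (hΓ0 : ∀ t ∈ Icc 0 T, 0 ≤ Γ t)
    (hΓ : ∀ t ∈ Icc 0 T, ∀ x ξ, -⟪ξ, fderiv ℝ (w t) x ξ⟫ ≤ Γ t * ‖ξ‖ ^ 2)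
    (hU : ContDiff ℝ ∞ U) (hUc : HasCompactSupport U)
    (hD : ∀ y, ‖w 0 y - U y‖ ≤ D) (hE₀ : 0 ≤ E₀) (hE0 : ∫ x, ‖U x - w 0 x‖ ^ 2 ≤ E₀ ^ 2)
    (hh : 0 < h) (hTs : (24 * oseenSliceConst (EuclideanSpace ℝ (Fin 3)) * (Bw + 1 + Bw)) ^ 2 * h ≤ 1)
    (hδ : δ ≤ 1 / 2)
    (hδ₁ : 2 * (D + 4 * h ^ (1 / 4 : ℝ) * G₂r) *
      Real.exp (36 * oseenSliceConst (EuclideanSpace ℝ (Fin 3)) ^ 2 * (Bw + 1 + Bw) ^ 2 * h) ≤ δ)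
    (hδ₂ : 2 * ((E₀ + G₂r * T) * Real.exp (∫ s in (0 : ℝ)..T, Γ s) + 4 * G₂r * h) * h ^ (-(3 / 4 : ℝ)) ≤ δ)
    {s : ℝ} (hs0 : 0 < s) (hsT : s ≤ T)
    {v : ℝ → EuclideanSpace ℝ (Fin 3) → EuclideanSpace ℝ (Fin 3)} {q₀ : ℝ → EuclideanSpace ℝ (Fin 3) → ℝ}
    (hv : IsClassicalNSSolutionOn (Icc 0 s) 1 0 v q₀) (hv0 : v 0 = U)
    (hEv : ∃ C : ℝ≥0∞, C < ⊤ ∧ ∀ t ∈ Icc 0 s, ∫⁻ x, ‖v t x‖ₑ ^ 2 ≤ C) :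
    ∀ t ∈ Icc 0 s, ∀ x, ‖v t x - w t x‖ ≤ δ ∧ ‖v t x‖ ≤ Bw + 1 / 2 := by
  have hUs : UniqueDiffOn ℝ (Icc 0 s) := uniqueDiffOn_Icc hs0
  have hD0 : 0 ≤ D := (norm_nonneg _).trans (hD 0)
  have hD4 : D ≤ 1 / 4 := by
    have h1 : 1 ≤ Real.exp (36 * oseenSliceConst (EuclideanSpace ℝ (Fin 3)) ^ 2 * (Bw + 1 + Bw) ^ 2 * h) :=
      Real.one_le_exp (by positivity)
    have h2 : 0 ≤ 4 * h ^ (1 / 4 : ℝ) * G₂r := by positivity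
    have h3 : 2 * (D + 4 * h ^ (1 / 4 : ℝ) * G₂r) * 1 ≤ 2 * (D + 4 * h ^ (1 / 4 : ℝ) * G₂r) *
        Real.exp (36 * oseenSliceConst (EuclideanSpace ℝ (Fin 3)) ^ 2 * (Bw + 1 + Bw) ^ 2 * h) :=
      mul_le_mul_of_nonneg_left h1 (by positivity)
    linarith
  have hdec : HasRapidSpatialDecay U := hasRapidSpatialDecay_of_hasCompactSupport hU hUc
  have h₀ : ∀ m : ℕ, ∫⁻ x, ‖iteratedFDeriv ℝ m (v 0) x‖ₑ ^ 2 < ⊤ := fun m => by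
    rw [hv0]; exact hdec.lintegral_enorm_iteratedFDeriv_sq_lt_top m
  have hEv_nn : ∃ C : ℝ≥0, ∀ t ∈ Icc 0 s, ∫⁻ x, ‖v t x‖ₑ ^ 2 ≤ C := by
    obtain ⟨C, hC, hb⟩ := hEv
    exact ⟨C.toNNReal, fun t ht => (hb t ht).trans (ENNReal.coe_toNNReal hC.ne).ge⟩
  have hvSob : HasBoundedSobolevNormsOn (Icc 0 s) v :=
    hv.hasBoundedSobolevNormsOn_of_sobolevDatum_unforced one_pos hs0 hEv_nn h₀
  have hHk : IsHkClassicalSolutionOn (Icc 0 s) v q₀ := by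
    refine ⟨hv, fun n => ?_⟩
    obtain ⟨C, hC⟩ := hvSob n
    exact ⟨NNReal.sqrt C, fun t ht => eLpNorm_le_sqrt_of_lintegral_sq_le (hC t ht)⟩
  obtain ⟨q, hTao⟩ := hHk.exists_isTaoSolutionOn hs0
  obtain ⟨K, hK⟩ := linfty_bound_of_hasBoundedSobolevNormsOn_holds
    (fun t ht => ((hv.smooth_velocity.timeDerivWithin hUs).contDiff_slice ht).of_le (by norm_cast))
    hTao.sobolev_dt
  set K' : ℝ := max K 1 with hK'
  have hK'pos : 0 < K' := lt_of_lt_of_le one_pos (le_max_right _ _)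
  have hK'bd : ∀ t ∈ Icc 0 s, ∀ x, ‖FluidPDE.timeDerivWithin (Icc 0 s) v t x‖ ≤ K' := fun t ht x =>
    (hK t ht x).trans (le_max_left _ _)
  have hLip : ∀ t ∈ Icc 0 s, ∀ t' ∈ Icc 0 s, ∀ x, ‖v t' x - v t x‖ ≤ K' * |t' - t| := by
    intro t ht t' ht' x
    have h := Convex.norm_image_sub_le_of_norm_hasDerivWithin_le (f := fun τ => v τ x)
      (f' := fun τ => FluidPDE.timeDerivWithin (Icc 0 s) v τ x) (s := Icc 0 s)
      (fun τ hτ => hv.smooth_velocity.hasDerivWithinAt_timeDerivWithin hUs hτ x)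
      (fun τ hτ => hK'bd τ hτ x) (convex_Icc 0 s) ht ht'
    simpa [Real.norm_eq_abs] using h
  set τ : ℝ := 1 / (2 * K') with hτ
  have hτpos : 0 < τ := by rw [hτ]; positivity
  have hKτ : K' * τ = 1 / 2 := by rw [hτ]; field_simp
  have hU0 : ∀ x, ‖v 0 x‖ ≤ Bw + 1 / 2 := by
    intro x
    rw [hv0]
    have h1 : ‖U x‖ ≤ ‖w 0 x‖ + ‖w 0 x - U x‖ := by
      calc ‖U x‖ = ‖w 0 x - (w 0 x - U x)‖ := by rw [sub_sub_cancel]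
        _ ≤ ‖w 0 x‖ + ‖w 0 x - U x‖ := norm_sub_le _ _
    linarith [hbw 0 ⟨le_rfl, hT.le⟩ x, hD x]
  have step1 : ∀ t₁ ∈ Icc 0 s, 0 < t₁ → (∀ t ∈ Icc 0 t₁, ∀ y, ‖v t y‖ ≤ Bw + 1) →
      ∀ t ∈ Icc 0 t₁, ∀ x, ‖v t x - w t x‖ ≤ δ := by
    intro t₁ ht₁ ht₁0 hb
    have hsub1 : Icc 0 t₁ ⊆ Icc 0 s := Icc_subset_Icc le_rfl ht₁.2
    have hv1 : IsClassicalNSSolutionOn (Icc 0 t₁) 1 0 v q₀ := hv.mono hsub1 (uniqueDiffOn_Icc ht₁0)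
    have hEv1 : ∃ C : ℝ≥0∞, C < ⊤ ∧ ∀ t ∈ Icc 0 t₁, ∫⁻ x, ‖v t x‖ₑ ^ 2 ≤ C := by
      obtain ⟨C, hC, hb'⟩ := hEv; exact ⟨C, hC, fun t ht => hb' t (hsub1 ht)⟩
    exact freeRun_near_of_strain_of_bound hT hw hgc hGb hgdiv hG₂r hg2 hEw hwS hwt hϖS hBw hbw hΓc hΓ0 hΓ
      hU hUc hD hE₀ hE0 hh hTs hδ₁ hδ₂ ht₁0 (ht₁.2.trans hsT) hv1 hv0 hEv1 hb
  have claim : ∀ k : ℕ, ∀ t ∈ Icc 0 s, t ≤ k * τ → ∀ x, ‖v t x‖ ≤ Bw + 1 / 2 := by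
    intro k
    induction k with
    | zero =>
      intro t ht htk x
      have ht0 : t = 0 := le_antisymm (by simpa using htk) ht.1
      rw [ht0]; exact hU0 x
    | succ k ih =>
      intro t ht htk x
      rcases eq_or_lt_of_le ht.1 with h0 | h0
      · rw [← h0]; exact hU0 x
      have hb : ∀ t' ∈ Icc 0 t, ∀ y, ‖v t' y‖ ≤ Bw + 1 := by
        intro t' ht' y
        have ht's : t' ∈ Icc 0 s := ⟨ht'.1, ht'.2.trans ht.2⟩
        rcases le_or_gt t' (k * τ) with hle | hgt
        · linarith [ih t' ht's hle y]
        · have hkτs : (k : ℝ) * τ ∈ Icc 0 s := ⟨by positivity, hgt.le.trans ht's.2⟩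
          have h1 := ih (k * τ) hkτs le_rfl y
          have h2 := hLip (k * τ) hkτs t' ht's y
          have h3 : |t' - k * τ| ≤ τ := by
            rw [abs_of_pos (sub_pos.2 hgt)]
            have : t' ≤ (k + 1 : ℕ) * τ := ht'.2.trans htk
            push_cast at this
            linarith
          have h4 : ‖v t' y‖ ≤ ‖v (k * τ) y‖ + ‖v t' y - v (↑k * τ) y‖ := by
            calc ‖v t' y‖ = ‖v (k * τ) y + (v t' y - v (↑k * τ) y)‖ := by rw [add_sub_cancel]
              _ ≤ _ := norm_add_le _ _
          have h5 : K' * |t' - k * τ| ≤ K' * τ := mul_le_mul_of_nonneg_left h3 hK'pos.le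
          linarith
      have hclose := step1 t ht h0 hb t ⟨ht.1, le_rfl⟩ x
      calc ‖v t x‖ = ‖w t x + (v t x - w t x)‖ := by rw [add_sub_cancel]
        _ ≤ ‖w t x‖ + ‖v t x - w t x‖ := norm_add_le _ _
        _ ≤ Bw + 1 / 2 := by linarith [hbw t ⟨ht.1, ht.2.trans hsT⟩ x]
  obtain ⟨k, hk⟩ := exists_nat_ge (s / τ)
  have hsk : s ≤ k * τ := by rwa [div_le_iff₀ hτpos] at hk
  have hbd : ∀ t ∈ Icc 0 s, ∀ y, ‖v t y‖ ≤ Bw + 1 / 2 := fun t ht y =>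
    claim k t ht (ht.2.trans hsk) y
  intro t ht x
  exact ⟨step1 s ⟨hs0.le, le_rfl⟩ hs0 (fun t' ht' y => by linarith [hbd t' ht' y]) t ht x, hbd t ht x⟩

end Near

/-! ## §3 THE STRAIN-SHADOWED RUN: existence on the whole slab -/

section Main

variable {T Bw Gb G₂r D E₀ h δ : ℝ}
  {w g : ℝ → EuclideanSpace ℝ (Fin 3) → EuclideanSpace ℝ (Fin 3)}
  {ϖ : ℝ → EuclideanSpace ℝ (Fin 3) → ℝ} {Γ : ℝ → ℝ}
  {U : EuclideanSpace ℝ (Fin 3) → EuclideanSpace ℝ (Fin 3)}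

/-- The zero force is smooth on the closed half-space. [cite: FeffermanClay2006, (5) (6)] -/
private theorem isSmoothOnHalfSpace_zero_force :
    IsSmoothOnHalfSpace (0 : ℝ → EuclideanSpace ℝ (Fin 3) → EuclideanSpace ℝ (Fin 3)) := by
  have h : uncurry (0 : ℝ → EuclideanSpace ℝ (Fin 3) → EuclideanSpace ℝ (Fin 3)) = fun _ => 0 := by
    funext q; rfl
  rw [IsSmoothOnHalfSpace, h]; exact contDiffOn_const

/-- The zero force has Fefferman's space-time decay. [cite: FeffermanClay2006, (5) (6)] -/
private theorem hasRapidSpaceTimeDecay_zero_force :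
    HasRapidSpaceTimeDecay (0 : ℝ → EuclideanSpace ℝ (Fin 3) → EuclideanSpace ℝ (Fin 3)) := by
  intro n K
  have h : uncurry (0 : ℝ → EuclideanSpace ℝ (Fin 3) → EuclideanSpace ℝ (Fin 3)) = 0 := by
    funext q; rfl
  refine ⟨0, fun t _ x => ?_⟩
  rw [h, iteratedFDerivWithin_zero]
  simp

/-- **THE STRAIN-SHADOWED RUN (existence and sup-closeness at the strain fee).** Under the hypotheses of
the module docstring, the UNFORCED system has a classical finite-energy solution `(v, q)` on `[0, T] × ℝ³`
with `v 0 = U` and `‖v(t,x) − w(t,x)‖ ≤ δ` (§2 bounds every free run from `U` by `B_w + 1/2`;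
`ClayEvolution.exists_classical_Icc_of_apriori_bound` gives existence); fee `e^{∫₀ᵀ Γ}`.
[cite: DashtiRobinson2008, Thm. 5] [cite: RobinsonRodrigoSadowski2016, Thm. 9.1]
[cite: Tao2011, Thm. 5.4 (ii)+(iv)] [cite: Leray1934, §19 (3.4)–(3.8)] -/
theorem exists_freeRun_near_of_strain (hT : 0 < T)
    (hw : IsClassicalNSSolutionOn (Icc 0 T) 1 g w ϖ)
    (hgc : Continuous (uncurry g)) (hGb : ∀ τ ∈ Icc 0 T, ∀ y, ‖g τ y‖ ≤ Gb)
    (hgdiv : ∀ τ ∈ Icc 0 T, IsWeaklyDivFree (g τ)) (hG₂r : 0 ≤ G₂r)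
    (hg2 : ∀ τ ∈ Icc 0 T, eLpNorm (g τ) 2 volume ≤ ENNReal.ofReal G₂r)
    (hEw : ∃ C : ℝ≥0∞, C < ⊤ ∧ ∀ t ∈ Icc 0 T, ∫⁻ x, ‖w t x‖ₑ ^ 2 ≤ C)
    (hwS : HasBoundedSobolevNormsOn (Icc 0 T) w)
    (hwt : HasBoundedSobolevNormsOn (Icc 0 T) (FluidPDE.timeDerivWithin (Icc 0 T) w))
    (hϖS : ∀ n : ℕ, ∃ C' : ℝ≥0, ∀ t ∈ Icc 0 T, ∫⁻ x, ‖iteratedFDeriv ℝ n (ϖ t) x‖ₑ ^ 2 ≤ C')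
    (hBw : 0 < Bw) (hbw : ∀ t ∈ Icc 0 T, ∀ y, ‖w t y‖ ≤ Bw)
    (hΓc : ContinuousOn Γ (Icc 0 T)) (hΓ0 : ∀ t ∈ Icc 0 T, 0 ≤ Γ t)
    (hΓ : ∀ t ∈ Icc 0 T, ∀ x ξ, -⟪ξ, fderiv ℝ (w t) x ξ⟫ ≤ Γ t * ‖ξ‖ ^ 2)
    (hU : ContDiff ℝ ∞ U) (hUc : HasCompactSupport U) (hUdiv : VectorCalculus.IsDivFree U)
    (hD : ∀ y, ‖w 0 y - U y‖ ≤ D) (hE₀ : 0 ≤ E₀) (hE0 : ∫ x, ‖U x - w 0 x‖ ^ 2 ≤ E₀ ^ 2)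
    (hh : 0 < h) (hTs : (24 * oseenSliceConst (EuclideanSpace ℝ (Fin 3)) * (Bw + 1 + Bw)) ^ 2 * h ≤ 1)
    (hδ : δ ≤ 1 / 2)
    (hδ₁ : 2 * (D + 4 * h ^ (1 / 4 : ℝ) * G₂r) *
      Real.exp (36 * oseenSliceConst (EuclideanSpace ℝ (Fin 3)) ^ 2 * (Bw + 1 + Bw) ^ 2 * h) ≤ δ)
    (hδ₂ : 2 * ((E₀ + G₂r * T) * Real.exp (∫ s in (0 : ℝ)..T, Γ s) + 4 * G₂r * h) * h ^ (-(3 / 4 : ℝ)) ≤ δ) :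
    ∃ (v : ℝ → EuclideanSpace ℝ (Fin 3) → EuclideanSpace ℝ (Fin 3))
      (q : ℝ → EuclideanSpace ℝ (Fin 3) → ℝ),
      IsClassicalNSSolutionOn (Icc 0 T) 1 0 v q ∧ v 0 = U ∧
      (∃ C : ℝ≥0∞, C < ⊤ ∧ ∀ t ∈ Icc 0 T, ∫⁻ x, ‖v t x‖ₑ ^ 2 ≤ C) ∧
      ∀ t ∈ Icc 0 T, ∀ x, ‖v t x - w t x‖ ≤ δ := by
  have hdec : HasRapidSpatialDecay U := hasRapidSpatialDecay_of_hasCompactSupport hU hUc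
  have hapriori : ∀ T' ∈ Ioc 0 T,
      ∀ (u : ℝ → EuclideanSpace ℝ (Fin 3) → EuclideanSpace ℝ (Fin 3))
        (p : ℝ → EuclideanSpace ℝ (Fin 3) → ℝ),
        IsClassicalNSSolutionOn (Icc 0 T') 1 0 u p → u 0 = U →
        (∃ C : ℝ≥0∞, C < ⊤ ∧ ∀ t ∈ Icc 0 T', ∫⁻ x, ‖u t x‖ₑ ^ 2 ≤ C) →
        ∀ t ∈ Icc 0 T', ∀ x, ‖u t x‖ ≤ Bw + 1 / 2 :=
    fun T' hT' u p hcl h0 hE t ht x =>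
      (freeRun_near_of_strain hT hw hgc hGb hgdiv hG₂r hg2 hEw hwS hwt hϖS hBw hbw hΓc hΓ0 hΓ hU hUc hD
        hE₀ hE0 hh hTs hδ hδ₁ hδ₂ hT'.1 hT'.2 hcl h0 hE t ht x).2
  obtain ⟨v, q, hcl, hv0, hEv, -⟩ :=
    ClayEvolution.exists_classical_Icc_of_apriori_bound one_pos hU (fun x => hUdiv x) hdec
      isSmoothOnHalfSpace_zero_force hasRapidSpaceTimeDecay_zero_force hT hapriori
  exact ⟨v, q, hcl, hv0, hEv, fun t ht x =>
    (freeRun_near_of_strain hT hw hgc hGb hgdiv hG₂r hg2 hEw hwS hwt hϖS hBw hbw hΓc hΓ0 hΓ hU hUc hD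
      hE₀ hE0 hh hTs hδ hδ₁ hδ₂ hT le_rfl hcl hv0 hEv t ht x).1⟩

end Main

end Summit.NavierStokesRegularity.FluidComputer.PalasekTowerClayBridge.StrainShadow

end
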